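import Summits.AtomisticToContinuum.Crystallization.Theorems.ChessboardParticlePlanesPeriodicWindowsGapSqueezeCompetitor2

/-!
# Crux `PeriodicWindows` (stmt-AtomisticToContinuum-3240), line `dense-laminar-hull` — the rotation by `2π/3` about
# `e₃` (stub `hc_rot3` of the hollow closing, lead c12)

The rotation `T` of `ℝ³` by `2π/3` about the vertical axis,
`T (x, y, z) = (-x/2 - (√3/2) y, (√3/2) x - y/2, z)`, as an additive monoid hom (`hcr_exists_rot`), together with the
properties used by the symmetrisation step of the hollow closing (`hc_rot3`): `T` preserves norms,
`T v₁(a) = v₂(a) - v₁(a)`, `T v₂(a) = -v₁(a)`, `T e₃ = e₃`, `T` is `ℝ`-homogeneous, maps horizontal vectors to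
horizontal vectors, `ξ + T ξ + T (T ξ) = 0` for horizontal `ξ` (`1 + ω + ω² = 0`), and the second-moment identity
`∑ₖ (‖u + Tᵏ ξ‖² - ‖u‖² - ‖ξ‖²)² = 6 ‖u‖² ‖ξ‖²` for horizontal `u, ξ` (each bracket is `2 ⟪u, Tᵏ ξ⟫`, and
`∑ₖ ⟪u, R_{2πk/3} ξ⟫² = (3/2) ‖u‖² ‖ξ‖²` in the plane). Everything is a coordinate computation with `(√3)² = 3`.
[folklore]
-/

noncomputable section

namespace Summit.AtomisticToContinuum.Crystallization.Theorems.PeriodicWindowsDenseLaminarHull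

open Literature.MathematicalPhysics.StatisticalMechanics Filter Metric
open scoped BigOperators

/-- **The rotation by `2π/3` about `e₃` as an additive monoid hom**: there is `T : ℝ³ →+ ℝ³` with coordinates
`T w = (-w₀/2 - (√3/2) w₁, (√3/2) w₀ - w₁/2, w₂)`. [folklore] -/
theorem hcr_exists_rot : ∃ T : EuclideanSpace ℝ (Fin 3) →+ EuclideanSpace ℝ (Fin 3),
    ∀ w : EuclideanSpace ℝ (Fin 3), T w 0 = -(1 / 2) * w 0 - √3 / 2 * w 1 ∧
      T w 1 = √3 / 2 * w 0 - (1 / 2) * w 1 ∧ T w 2 = w 2 :=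
  ⟨{ toFun := fun w => !₂[-(1 / 2) * w 0 - √3 / 2 * w 1, √3 / 2 * w 0 - (1 / 2) * w 1, w 2]
     map_zero' := by
       ext i
       fin_cases i <;> simp
     map_add' := fun v w => by
       ext i
       fin_cases i <;> simp <;> ring }, fun _ => ⟨rfl, rfl, rfl⟩⟩

/-- **The rotation by `2π/3` about `e₃`** (stub `hc_rot3` of the hollow closing): an additive monoid hom `T` of `ℝ³`
preserving norms with `T v₁(a) = v₂(a) - v₁(a)`, `T v₂(a) = -v₁(a)`, `T e₃ = e₃`, `ℝ`-homogeneous, preserving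
horizontality, with `ξ + T ξ + T² ξ = 0` for horizontal `ξ` and the second-moment identity
`∑ₖ (‖u + Tᵏ ξ‖² - ‖u‖² - ‖ξ‖²)² = 6 ‖u‖² ‖ξ‖²` for horizontal `u, ξ`. [folklore] -/
theorem hc_rot3 : ∀ a : ℝ, ∃ T : EuclideanSpace ℝ (Fin 3) →+ EuclideanSpace ℝ (Fin 3),
    (∀ w, ‖T w‖ = ‖w‖) ∧ T (triangularVec₁ a) = triangularVec₂ a - triangularVec₁ a ∧
    T (triangularVec₂ a) = -triangularVec₁ a ∧ T (layerNormal 1) = layerNormal 1 ∧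
    (∀ (c : ℝ) (w : EuclideanSpace ℝ (Fin 3)), T (c • w) = c • T w) ∧
    (∀ w : EuclideanSpace ℝ (Fin 3), w 2 = 0 → (T w) 2 = 0) ∧
    (∀ ξ : EuclideanSpace ℝ (Fin 3), ξ 2 = 0 → ξ + T ξ + T (T ξ) = 0) ∧
    (∀ u ξ : EuclideanSpace ℝ (Fin 3), u 2 = 0 → ξ 2 = 0 →
      (‖u + ξ‖ ^ 2 - ‖u‖ ^ 2 - ‖ξ‖ ^ 2) ^ 2 + (‖u + T ξ‖ ^ 2 - ‖u‖ ^ 2 - ‖ξ‖ ^ 2) ^ 2 +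
        (‖u + T (T ξ)‖ ^ 2 - ‖u‖ ^ 2 - ‖ξ‖ ^ 2) ^ 2 = 6 * ‖u‖ ^ 2 * ‖ξ‖ ^ 2) := by
  intro a
  obtain ⟨T, hT⟩ := hcr_exists_rot
  have hT0 : ∀ w : EuclideanSpace ℝ (Fin 3), T w 0 = -(1 / 2) * w 0 - √3 / 2 * w 1 := fun w => (hT w).1
  have hT1 : ∀ w : EuclideanSpace ℝ (Fin 3), T w 1 = √3 / 2 * w 0 - (1 / 2) * w 1 := fun w => (hT w).2.1
  have hT2 : ∀ w : EuclideanSpace ℝ (Fin 3), T w 2 = w 2 := fun w => (hT w).2.2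
  have h3 : (√3 : ℝ) ^ 2 = 3 := Real.sq_sqrt (by norm_num)
  -- coordinates of the literature vectors
  obtain ⟨h10, h11, h12⟩ : (triangularVec₁ a) 0 = a ∧ (triangularVec₁ a) 1 = 0 ∧ (triangularVec₁ a) 2 = 0 := by
    simp [triangularVec₁]
  obtain ⟨h20, h21, h22⟩ :
      (triangularVec₂ a) 0 = a / 2 ∧ (triangularVec₂ a) 1 = a * √3 / 2 ∧ (triangularVec₂ a) 2 = 0 := by
    simp [triangularVec₂]
  obtain ⟨he0, he1, -⟩ : (layerNormal 1 : EuclideanSpace ℝ (Fin 3)) 0 = 0 ∧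
      (layerNormal 1 : EuclideanSpace ℝ (Fin 3)) 1 = 0 ∧ (layerNormal 1 : EuclideanSpace ℝ (Fin 3)) 2 = 1 := by
    simp [layerNormal]
  -- coordinates of `T (T ξ)` (the rotation by `4π/3`)
  have hTT0 : ∀ ξ : EuclideanSpace ℝ (Fin 3), T (T ξ) 0 = -(1 / 2) * ξ 0 + √3 / 2 * ξ 1 := fun ξ => by
    rw [hT0 (T ξ), hT0 ξ, hT1 ξ]
    linear_combination (-(ξ 0) / 4) * h3
  have hTT1 : ∀ ξ : EuclideanSpace ℝ (Fin 3), T (T ξ) 1 = -(√3 / 2) * ξ 0 - (1 / 2) * ξ 1 := fun ξ => by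
    rw [hT1 (T ξ), hT0 ξ, hT1 ξ]
    linear_combination (-(ξ 1) / 4) * h3
  -- norm preservation
  have hnsq : ∀ w : EuclideanSpace ℝ (Fin 3), ‖T w‖ ^ 2 = ‖w‖ ^ 2 := fun w => by
    rw [gsc_norm_sq_eq (T w), gsc_norm_sq_eq w, hT0, hT1, hT2]
    linear_combination ((w 0) ^ 2 / 4 + (w 1) ^ 2 / 4) * h3
  have hnorm : ∀ w : EuclideanSpace ℝ (Fin 3), ‖T w‖ = ‖w‖ := fun w => by
    rw [← Real.sqrt_sq (norm_nonneg (T w)), hnsq, Real.sqrt_sq (norm_nonneg w)]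
  -- horizontality
  have hhor : ∀ w : EuclideanSpace ℝ (Fin 3), w 2 = 0 → (T w) 2 = 0 := fun w hw => by rw [hT2, hw]
  -- `‖u + η‖² - ‖u‖² - ‖η‖² = 2 ⟪u, η⟫` for horizontal `u, η`
  have hbr : ∀ u η : EuclideanSpace ℝ (Fin 3), u 2 = 0 → η 2 = 0 →
      ‖u + η‖ ^ 2 - ‖u‖ ^ 2 - ‖η‖ ^ 2 = 2 * (u 0 * η 0 + u 1 * η 1) := fun u η hu hη => by
    rw [gsc_norm_sq_eq (u + η), gsc_norm_sq_eq u, gsc_norm_sq_eq η, PiLp.add_apply, PiLp.add_apply,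
      PiLp.add_apply, hu, hη]
    ring
  refine ⟨T, hnorm, ?_, ?_, ?_, ?_, hhor, ?_, ?_⟩
  · -- `T v₁ = v₂ - v₁`
    have e0 : T (triangularVec₁ a) 0 = (triangularVec₂ a - triangularVec₁ a) 0 := by
      rw [hT0, PiLp.sub_apply, h10, h11, h20]
      ring
    have e1 : T (triangularVec₁ a) 1 = (triangularVec₂ a - triangularVec₁ a) 1 := by
      rw [hT1, PiLp.sub_apply, h10, h11, h21]
      ring
    have e2 : T (triangularVec₁ a) 2 = (triangularVec₂ a - triangularVec₁ a) 2 := by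
      rw [hT2, PiLp.sub_apply, h12, h22]
      ring
    ext i
    fin_cases i
    exacts [e0, e1, e2]
  · -- `T v₂ = -v₁`
    have e0 : T (triangularVec₂ a) 0 = (-triangularVec₁ a) 0 := by
      rw [hT0, PiLp.neg_apply, h20, h21, h10]
      linear_combination (-a / 4) * h3
    have e1 : T (triangularVec₂ a) 1 = (-triangularVec₁ a) 1 := by
      rw [hT1, PiLp.neg_apply, h20, h21, h11]
      ring
    have e2 : T (triangularVec₂ a) 2 = (-triangularVec₁ a) 2 := by
      rw [hT2, PiLp.neg_apply, h22, h12]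
      ring
    ext i
    fin_cases i
    exacts [e0, e1, e2]
  · -- `T e₃ = e₃`
    have e0 : T (layerNormal 1) 0 = (layerNormal 1 : EuclideanSpace ℝ (Fin 3)) 0 := by
      rw [hT0, he0, he1]
      ring
    have e1 : T (layerNormal 1) 1 = (layerNormal 1 : EuclideanSpace ℝ (Fin 3)) 1 := by
      rw [hT1, he0, he1]
      ring
    have e2 : T (layerNormal 1) 2 = (layerNormal 1 : EuclideanSpace ℝ (Fin 3)) 2 := hT2 _
    ext i
    fin_cases i
    exacts [e0, e1, e2]
  · -- `ℝ`-homogeneity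
    intro c w
    have e0 : T (c • w) 0 = (c • T w) 0 := by
      simp only [hT0, PiLp.smul_apply, smul_eq_mul]
      ring
    have e1 : T (c • w) 1 = (c • T w) 1 := by
      simp only [hT1, PiLp.smul_apply, smul_eq_mul]
      ring
    have e2 : T (c • w) 2 = (c • T w) 2 := by
      rw [hT2, PiLp.smul_apply, PiLp.smul_apply, hT2]
    ext i
    fin_cases i
    exacts [e0, e1, e2]
  · -- `ξ + T ξ + T (T ξ) = 0` for horizontal `ξ`
    intro ξ hξ
    have e0 : (ξ + T ξ + T (T ξ)) 0 = (0 : EuclideanSpace ℝ (Fin 3)) 0 := by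
      rw [PiLp.add_apply, PiLp.add_apply, hTT0, hT0, PiLp.zero_apply]
      ring
    have e1 : (ξ + T ξ + T (T ξ)) 1 = (0 : EuclideanSpace ℝ (Fin 3)) 1 := by
      rw [PiLp.add_apply, PiLp.add_apply, hTT1, hT1, PiLp.zero_apply]
      ring
    have e2 : (ξ + T ξ + T (T ξ)) 2 = (0 : EuclideanSpace ℝ (Fin 3)) 2 := by
      rw [PiLp.add_apply, PiLp.add_apply, hT2 (T ξ), hT2 ξ, hξ, PiLp.zero_apply]
      ring
    ext i
    fin_cases i
    exacts [e0, e1, e2]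
  · -- the second-moment identity
    intro u ξ hu hξ
    have hTξ : (T ξ) 2 = 0 := hhor ξ hξ
    have hTTξ : (T (T ξ)) 2 = 0 := hhor (T ξ) hTξ
    have h0 := hbr u ξ hu hξ
    have h1 : ‖u + T ξ‖ ^ 2 - ‖u‖ ^ 2 - ‖ξ‖ ^ 2 =
        2 * (u 0 * (-(1 / 2) * ξ 0 - √3 / 2 * ξ 1) + u 1 * (√3 / 2 * ξ 0 - (1 / 2) * ξ 1)) := by
      rw [← hnsq ξ, hbr u (T ξ) hu hTξ, hT0, hT1]
    have h2 : ‖u + T (T ξ)‖ ^ 2 - ‖u‖ ^ 2 - ‖ξ‖ ^ 2 =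
        2 * (u 0 * (-(1 / 2) * ξ 0 + √3 / 2 * ξ 1) + u 1 * (-(√3 / 2) * ξ 0 - (1 / 2) * ξ 1)) := by
      rw [← hnsq ξ, ← hnsq (T ξ), hbr u (T (T ξ)) hu hTTξ, hTT0, hTT1]
    rw [h0, h1, h2, gsc_norm_sq_eq u, gsc_norm_sq_eq ξ, hu, hξ]
    linear_combination (2 * (u 0 * ξ 1 - u 1 * ξ 0) ^ 2) * h3

end Summit.AtomisticToContinuum.Crystallization.Theorems.PeriodicWindowsDenseLaminarHull

end
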